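import Summits.Ventures.PercRepro.S3MidKeyNine
import Summits.Ventures.PercRepro.S4FlatBoundsSharp
import Summits.Ventures.PercRepro.HyperplaneKeySizeMono

/-!
# PercRepro — THE MIDDLE KEY AT LEVEL `7`: THE BASE (p1, gen 45; an S4 feeder — p9 owns SUBCLAIM-S4; no window claim here)

The level-`7` instance of p7's middle key (S3MidKey*, proofs/P7-S3-MIDKEY-G21.md): one exact dual certificate of the `n`-monotone
LP (unsplit upward rows at the ranks `7, 8, 9` with the constant coloop counts, closure rows with the CONSTANT `e`-free flat
bounds `f(7) = 79`, `f(8) = 159`, `#uSets k ≤ m[k,7]`, the `Y` rows) at `n₀` proves `Φ(p, 7)·#U ≤ #Y` on every `e`-free core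
of rank `p` with `n ≥ n₀` points (the only `n` in a row is the factor `n − k` on the `≤` side, multiplying a count). This module
holds the two level-`7` ingredients the row modules `S4MidKey<Word>` share: `topCount_le_sum_uSets_seven` (`#U(p, 7) ≤
Σ_{7 ≤ k ≤ 79} #uSets k`: a `U`-set's complement is a rank-`7` set of `7 … 79` points) and the numerals `phiK_<word>_seven`
(`Φ(p, 7)` for `p = 10 … 25`, from `phiK_eq_two_pow_sub`). Coloops are not excluded. Axioms: standard.
-/

open scoped Matroid

namespace PercRepro

namespace S4Mid

open Set Finset S2LP S3Mid

variable {α : Type} {M : Matroid α} [M.Finite]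

/-- **`#U(p, 7) ≤ Σ_{7 ≤ k ≤ 79} #uSets k`**: the complement of a `U`-set is a rank-`7` set, of `7 … 79` points when every
rank-`7` set has `≤ 79` points. -/
theorem topCount_le_sum_uSets_seven (p : ℕ) (h79 : ∀ X ⊆ M.E, M.eRk X ≤ ((7 : ℕ) : ℕ∞) → X.ncard ≤ 79)
    (hn79 : 79 ≤ M.E.ncard) :
    Matroid.topCount M p 7 ≤ ∑ i ∈ Finset.range 73, (uSets M p 7 (7 + i)).ncard := by
  rw [topCount_eq_sum_uSets, ← S3LP.sum_Icc_eq_sum_range (fun k => (uSets M p 7 k).ncard) 7 79]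
  refine le_of_eq (Finset.sum_subset ?_ ?_).symm
  · intro k hk
    simp only [Finset.mem_Icc] at hk
    simp only [Finset.mem_range]
    omega
  · intro k _ hk
    simp only [Finset.mem_Icc, not_and_or, not_le] at hk
    have h1 := ncard_uSets_le_rkSets (M := M) p 7 k
    rcases hk with hk | hk
    · rw [S3LP.z_lt k 7 hk] at h1; omega
    · rw [rkSets_eq_empty_of_flat h79 le_rfl hk, Set.ncard_empty] at h1; omega

/-- `Φ(10, 7) = 5 / 2`. -/
theorem phiK_ten_seven : phiK 10 7 = 5 / 2 := by
  rw [HypKey.phiK_eq_two_pow_sub 10 7 (by norm_num), Nat.choose_symm_add]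
  simp only [Finset.sum_range_succ, Finset.sum_range_zero]
  norm_num [Nat.choose_eq_descFactorial_div_factorial, Nat.descFactorial_succ, Nat.descFactorial_zero, Nat.factorial]

/-- `Φ(11, 7) = 77 / 18`. -/
theorem phiK_eleven_seven : phiK 11 7 = 77 / 18 := by
  rw [HypKey.phiK_eq_two_pow_sub 11 7 (by norm_num), Nat.choose_symm_add]
  simp only [Finset.sum_range_succ, Finset.sum_range_zero]
  norm_num [Nat.choose_eq_descFactorial_div_factorial, Nat.descFactorial_succ, Nat.descFactorial_zero, Nat.factorial]

/-- `Φ(12, 7) = 20 / 3`. -/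
theorem phiK_twelve_seven : phiK 12 7 = 20 / 3 := by
  rw [HypKey.phiK_eq_two_pow_sub 12 7 (by norm_num), Nat.choose_symm_add]
  simp only [Finset.sum_range_succ, Finset.sum_range_zero]
  norm_num [Nat.choose_eq_descFactorial_div_factorial, Nat.descFactorial_succ, Nat.descFactorial_zero, Nat.factorial]

/-- `Φ(13, 7) = 299 / 30`. -/
theorem phiK_thirteen_seven : phiK 13 7 = 299 / 30 := by
  rw [HypKey.phiK_eq_two_pow_sub 13 7 (by norm_num), Nat.choose_symm_add]
  simp only [Finset.sum_range_succ, Finset.sum_range_zero]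
  norm_num [Nat.choose_eq_descFactorial_div_factorial, Nat.descFactorial_succ, Nat.descFactorial_zero, Nat.factorial]

/-- `Φ(14, 7) = 658 / 45`. -/
theorem phiK_fourteen_seven : phiK 14 7 = 658 / 45 := by
  rw [HypKey.phiK_eq_two_pow_sub 14 7 (by norm_num), Nat.choose_symm_add]
  simp only [Finset.sum_range_succ, Finset.sum_range_zero]
  norm_num [Nat.choose_eq_descFactorial_div_factorial, Nat.descFactorial_succ, Nat.descFactorial_zero, Nat.factorial]

/-- `Φ(15, 7) = 703 / 33`. -/
theorem phiK_fifteen_seven : phiK 15 7 = 703 / 33 := by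
  rw [HypKey.phiK_eq_two_pow_sub 15 7 (by norm_num), Nat.choose_symm_add]
  simp only [Finset.sum_range_succ, Finset.sum_range_zero]
  norm_num [Nat.choose_eq_descFactorial_div_factorial, Nat.descFactorial_succ, Nat.descFactorial_zero, Nat.factorial]

/-- `Φ(16, 7) = 1024 / 33`. -/
theorem phiK_sixteen_seven : phiK 16 7 = 1024 / 33 := by
  rw [HypKey.phiK_eq_two_pow_sub 16 7 (by norm_num), Nat.choose_symm_add]
  simp only [Finset.sum_range_succ, Finset.sum_range_zero]
  norm_num [Nat.choose_eq_descFactorial_div_factorial, Nat.descFactorial_succ, Nat.descFactorial_zero, Nat.factorial]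

/-- `Φ(17, 7) = 17969 / 396`. -/
theorem phiK_seventeen_seven : phiK 17 7 = 17969 / 396 := by
  rw [HypKey.phiK_eq_two_pow_sub 17 7 (by norm_num), Nat.choose_symm_add]
  simp only [Finset.sum_range_succ, Finset.sum_range_zero]
  norm_num [Nat.choose_eq_descFactorial_div_factorial, Nat.descFactorial_succ, Nat.descFactorial_zero, Nat.factorial]

/-- `Φ(18, 7) = 3673 / 55`. -/
theorem phiK_eighteen_seven : phiK 18 7 = 3673 / 55 := by
  rw [HypKey.phiK_eq_two_pow_sub 18 7 (by norm_num), Nat.choose_symm_add]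
  simp only [Finset.sum_range_succ, Finset.sum_range_zero]
  norm_num [Nat.choose_eq_descFactorial_div_factorial, Nat.descFactorial_succ, Nat.descFactorial_zero, Nat.factorial]

/-- `Φ(19, 7) = 70832 / 715`. -/
theorem phiK_nineteen_seven : phiK 19 7 = 70832 / 715 := by
  rw [HypKey.phiK_eq_two_pow_sub 19 7 (by norm_num), Nat.choose_symm_add]
  simp only [Finset.sum_range_succ, Finset.sum_range_zero]
  norm_num [Nat.choose_eq_descFactorial_div_factorial, Nat.descFactorial_succ, Nat.descFactorial_zero, Nat.factorial]

/-- `Φ(20, 7) = 190792 / 1287`. -/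
theorem phiK_twenty_seven : phiK 20 7 = 190792 / 1287 := by
  rw [HypKey.phiK_eq_two_pow_sub 20 7 (by norm_num), Nat.choose_symm_add]
  simp only [Finset.sum_range_succ, Finset.sum_range_zero]
  norm_num [Nat.choose_eq_descFactorial_div_factorial, Nat.descFactorial_succ, Nat.descFactorial_zero, Nat.factorial]

/-- `Φ(21, 7) = 192079 / 858`. -/
theorem phiK_twentyone_seven : phiK 21 7 = 192079 / 858 := by
  rw [HypKey.phiK_eq_two_pow_sub 21 7 (by norm_num), Nat.choose_symm_add]
  simp only [Finset.sum_range_succ, Finset.sum_range_zero]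
  norm_num [Nat.choose_eq_descFactorial_div_factorial, Nat.descFactorial_succ, Nat.descFactorial_zero, Nat.factorial]

/-- `Φ(22, 7) = 13306 / 39`. -/
theorem phiK_twentytwo_seven : phiK 22 7 = 13306 / 39 := by
  rw [HypKey.phiK_eq_two_pow_sub 22 7 (by norm_num), Nat.choose_symm_add]
  simp only [Finset.sum_range_succ, Finset.sum_range_zero]
  norm_num [Nat.choose_eq_descFactorial_div_factorial, Nat.descFactorial_succ, Nat.descFactorial_zero, Nat.factorial]

/-- `Φ(23, 7) = 61387 / 117`. -/
theorem phiK_twentythree_seven : phiK 23 7 = 61387 / 117 := by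
  rw [HypKey.phiK_eq_two_pow_sub 23 7 (by norm_num), Nat.choose_symm_add]
  simp only [Finset.sum_range_succ, Finset.sum_range_zero]
  norm_num [Nat.choose_eq_descFactorial_div_factorial, Nat.descFactorial_succ, Nat.descFactorial_zero, Nat.factorial]

/-- `Φ(24, 7) = 31744 / 39`. -/
theorem phiK_twentyfour_seven : phiK 24 7 = 31744 / 39 := by
  rw [HypKey.phiK_eq_two_pow_sub 24 7 (by norm_num), Nat.choose_symm_add]
  simp only [Finset.sum_range_succ, Finset.sum_range_zero]
  norm_num [Nat.choose_eq_descFactorial_div_factorial, Nat.descFactorial_succ, Nat.descFactorial_zero, Nat.factorial]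

/-- `Φ(25, 7) = 794575 / 624`. -/
theorem phiK_twentyfive_seven : phiK 25 7 = 794575 / 624 := by
  rw [HypKey.phiK_eq_two_pow_sub 25 7 (by norm_num), Nat.choose_symm_add]
  simp only [Finset.sum_range_succ, Finset.sum_range_zero]
  norm_num [Nat.choose_eq_descFactorial_div_factorial, Nat.descFactorial_succ, Nat.descFactorial_zero, Nat.factorial]

end S4Mid

end PercRepro
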